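import Summits.BirchSwinnertonDyer.BirchSwinnertonDyer.Theorems.EisensteinPrimesMazurMCOnCellBTwistbackThmD
import Summits.BirchSwinnertonDyer.Rank1Residual.X2.CellCBDPValueLZZRoadInputOfFact
import HarnessLib

/-!
# Crux 3 `MazurMCOnCellB` (stmt-BirchSwinnertonDyer-19033), line `twistback` (v2 registered 16048b05…, v3 proposed by
# LEAD g8): the BDP VALUE AT `𝟙` AT AN ODD MULTIPLICATIVE PRIME — in particular the `p = 3` atom `stub_value3` /
# `hval3` of p633542 — FROM THE REFEREED LIU–ZHANG–ZHANG FACT, rank-free and sign-free; hence the Heegner-index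
# identity over `K` (item -27489's content) from Keller–Yin Thm. D + PUBLISHED facts at EVERY odd `p ‖ N`
# (cell `bsd-eis`, width seat bsd-line-x2-p1-w4 g3)

HONEST FRAMING (cell `bsd-eis`, run/shared/lean/pub/bsd-eis/): theorems only; nothing booked; X2 stays
CONSTRUCTION-SHAPED; no label or count moves; BSD / Mazur's main conjecture is proved for NO curve here. Every
theorem is CONDITIONAL on its displayed binders, all of which are NAMED LITERATURE FACTS taken BY NAME:
`LiuZhangZhang2018.thm151_thm153_modularCurve_heegnerVector` (Liu–Zhang–Zhang, Duke Math. J. 167 (2018) Thm. 1.5.1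
with Remark 1.1.2 ∧ Thm. 1.5.3 for `X₀(N) → E`, the Heegner test vector and `χ = 𝟙` at a prime `p ‖ N` split in
`K`; REFEREED; typed p509230), newforms, Gross–Zagier, GZK, Poitou–Tate ×2, Hsieh 2014 Thm. A (all PUB) and — in §3
only — `KellerYin2024.thmD_imcMult_exists_isBDPLFunction_isTorsion_charIdeal_eq_OPEN` (Keller–Yin arXiv:2402.12781v2
Thm. D = Thm. 5.1.3, UNREFEREED PREPRINT, printed proof gapped at L1754 — flag `KYD-gap`).

## Why (numbers, not adjectives)

LEAD g8's p632879/p633542 reduce the line's stub 3 (item -27489 `HeegnerIndexIdentityKRankOne`) to Thm. D + 4 PUB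
facts + ONE typed atom not taken from print: the BDP value at `𝟙` at `p = 3 ‖ N` for every ♭-frame
(`hval3` of `…TwistbackThmDByName.heegnerIndexIdentityKRankOne_of_thmD_OPEN_of_value3`; twistback v3's
`stub_value3`; all 127 cells of row A10 sit at `p = 3`). That atom is crux 4's registered `stub_c2`@3 content
re-keyed by the rank SUM, and crux 4's line b1 v10 already discharged `stub_c2`@3 from the refereed LZZ fact
(`Reoriented.stub_c2_of_thm151_thm153`). The chain it used — `X2.lzzRoadInputIoo_of_thm151_thm153` (k5-c4 g7) ⟹
`X2.LZZRoadInputIoo` ⟹ the pointwise continuous display `X2.exists_continuousDisplay_of_lzzRoadInputIoo` (cgshw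
g15) — carries NO rank hypothesis, NO `L(E^{d_K},1) ≠ 0`, NO sign at `p` and NO `p ≥ 5`: its binders are `p ≠ 2`
multiplicative, `N = N_E`, `K` imaginary quadratic with `d_K < −4` and Heegner for `N`, `p ∤ c(Dt)`, `P ↦ y_H`.
So the re-keying is one line of kernel glue plus X11b's one-sided ♭-rigidity — this file:

* §1 `bdpValueAtOneIntAt_of_lzzRoadInputIoo` / `bdpValueAtOneIntAt_of_thm151_thm153` — at ANY odd multiplicative
  `p`, either sign, any newform `f` of `W`, any `ι_K`, a Heegner point `P` of INFINITE order: every ♭-frame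
  `(Ω_K ≠ 0, Ω_p ≠ 0, Q ∈ 𝓞_{ℂ_p}⟦T⟧)` with `R1.IsBDPLFunctionInt p ι′ 𝔭 κ γ f Ω_K Ω_p Q` has
  `Q(𝟙) = u·((1 − a_p(E) p⁻¹)·log_𝔭 P)²`, `‖u‖ = 1` (`R1.BDPValueAtOneIntAt`). Proof = the 20-line block of
  `…TwistbackThmD.bdpValueAtOneIntAt_of_bdpDisplay_pNew` with the PRINTED display at `p ≥ 5` replaced by the LZZ
  display (`X11b.intSeries_constantCoeff_eq_of_isBDPLFunctionInt_of_continuousValues`).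
* §2 `value3_of_thm151_thm153` — **the `hval3` / `stub_value3` body VERBATIM** (its `p = 3`, rank-sum and
  reducibility binders are simply not used) ⇐ newforms ∧ Gross–Zagier ∧ LZZ (non-torsion of `P` from
  `ord_{s=1} L(E/K,s) = r_an(E) + r_an(E^{(d_K)}) = 1`, as in `…TwistbackThmD` §3).
* §3 `shaFinite_and_indexIdentityAt_of_thmD_OPEN_of_thm151_thm153` / `indexIdentityAt_of_thmD_OPEN_of_thm151_thm153`
  — at EVERY odd `p` (no `5 ≤ p`, no [cas-split]): `Ш(E/K)` finite and `X11b.IndexIdentityAt W p K P` from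
  Thm. D BY NAME + newforms + PT ×2 + Hsieh + GZ + GZK + LZZ, through an infinite place / through any `ι`
  (the binder shape of item -27489). = `…TwistbackThmD` §1 with `hval` supplied by §1 here.

Net effect on the line's bill: stub 3 of twistback = {Thm. D (PRE)} + PUBLISHED/REFEREED named facts — NO typed
atom; the by-name corollaries (item -27489 verbatim, `stub_value3` from `stub_publishedInputs` + LZZ, crux 3 by
name) live in the companion `…TwistbackValueOfLZZByName` (it imports the route file; this file does not).
What this is NOT: not a proof of Thm. D, of any main conjecture, or of BSD for any curve; the fidelity of the typed
LZZ fact at a Steinberg prime (Assumption 1.8.1 «p split»; readings R-D/R-D′/R-N2/R-P/R-M of LIT-DOSSIER §82/§86) is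
the referee's, not asserted here. Novel here: nothing mathematical — by-name composition of accepted kernels.

References: [LiuZhangZhang2018] Duke Math. J. 167 (2018) Thm. 1.5.1, Remark 1.1.2, Thm. 1.5.3 (pp. 745–749) =
arXiv:1511.08172 Thm. 1.6/1.8, Thm. 3.8/3.10, Prop. 4.12; [KellerYin2024] Thm. D = Thm. 5.1.3 (PRE); [Castella2018]
Thm. 2.3, Thms. 3.1–3.2, §5; [Hsieh2014] Thm. A; [GrossZagier1986] I.(6.3), V.(2.1); [JetchevSkinnerWan2017] §7.4.1;
[MilneADT2006] I.4.10; c2v MEMO-1/2; cgshw MEMO-18/19.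
-/

set_option autoImplicit false
set_option linter.dupNamespace false

noncomputable section

open scoped Classical MatrixGroups ModularForm Topology

open Filter CongruenceSubgroup WeierstrassCurve NumberField IsDedekindDomain Field PowerSeries
  Literature.NumberTheory.EllipticCurves Literature.NumberTheory.EllipticCurves.GreenbergSelmer
  Literature.NumberTheory.EllipticCurves.ModularForms Literature.NumberTheory.QuadraticFields
  Literature.NumberTheory.EllipticCurves.Rank1Residual
  Literature.NumberTheory.EllipticCurves.Rank1Residual.Typed
  Literature.NumberTheory.EllipticCurves.Castella2018
  Literature.NumberTheory.EllipticCurves.Castella2018Exceptional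
  Literature.NumberTheory.GaloisRepresentations Literature.NumberTheory.GaloisCohomology
  Literature.NumberTheory.Automorphic
  Summit.BirchSwinnertonDyer.Rank1Residual.X11b.AcSelmer
  Summit.BirchSwinnertonDyer.Rank1Residual.X11b.Halves
  Summit.BirchSwinnertonDyer.Rank1Residual.X11b
  Summit.BirchSwinnertonDyer.Rank1Residual.X2
  Summit.BirchSwinnertonDyer.Rank1Residual

namespace Summit.BirchSwinnertonDyer.BirchSwinnertonDyer.Theorems.EisensteinPrimesMazurMCOnCellBTwistbackValueOfLZZ

open Summit.BirchSwinnertonDyer.BirchSwinnertonDyer.Theorems.EisensteinPrimesMazurMCOnCellBTwistbackThmD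

/-! ## §1. The BDP value at `𝟙` of every ♭-frame at an ODD MULTIPLICATIVE prime, from LZZ — rank-free, sign-free -/

/-- **The BDP value at `𝟙` for a ♭-frame at an odd multiplicative prime, FROM THE TYPED LZZ INPUT
`X2.LZZRoadInputIoo`** (Liu–Zhang–Zhang 2018 Thm. 3.8 ∧ 3.10 ∧ Prop. 4.12 in tree currency; implied by the
refereed fact, `X2.lzzRoadInputIoo_of_thm151_thm153`). Data: `W/ℚ` globally minimal of conductor `N`, `p` odd with
multiplicative reduction (EITHER sign), `K` imaginary quadratic with `d_K < −4` and Heegner for `N`, a datum `Dt`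
with `p ∤ c(Dt)`, a Heegner datum `H`, `P ∈ E(K)` with `P ↦ y_H` through `ι_K : K →+* ℂ` and of INFINITE ORDER, a
newform `f` of `W`, an anticyclotomic `(κ, γ)`, a degree-one `𝔭 ∋ p`, an embedding datum `ι′` inducing `𝔭`,
and a ♭-frame `(Ω_K ≠ 0, Ω_p ≠ 0, Q)` with `R1.IsBDPLFunctionInt p ι′ 𝔭 κ γ f Ω_K Ω_p Q`. Conclusion:
`Q(𝟙) = u·((1 − a_p(E) p⁻¹)·log_𝔭 P)²`, `‖u‖ = 1` (`R1.BDPValueAtOneIntAt`, `log` at `embAt K p 𝔭`). NO rank,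
NO `L(E^{d_K},1) ≠ 0`, NO `5 ≤ p`, NO sign hypothesis. Proof: the pointwise continuous display
`X2.exists_continuousDisplay_of_lzzRoadInputIoo` (virtual periods `Ω_K⁰, Ω_p⁰`, unit `u`) + the limit is non-zero
(`a_p = ±1`, `log_𝔭 P ≠ 0`) + one-sided ♭-rigidity
`X11b.intSeries_constantCoeff_eq_of_isBDPLFunctionInt_of_continuousValues` + `Q(𝟙) = [T⁰]Q`. CONDITIONAL on the
typed input `hL`; nothing booked.
[cite: LiuZhangZhang2018, Thm. 3.8 and Thm. 3.10 and Prop. 4.12 (arXiv:1511.08172 pp. 18, 23) = Duke Thm. 3.2.10, Thm. 3.3.2, Prop. 4.3.4 (source of the input; nothing asserted)]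
[cite: Castella2018, Thm. 3.1 and Thm. 3.2 (arXiv:1704.06608 p. 9) (the display's normalisation)] -/
theorem bdpValueAtOneIntAt_of_lzzRoadInputIoo (hL : X2.LZZRoadInputIoo)
    (W : WeierstrassCurve ℚ) [W.IsElliptic] [W.IsGloballyMinimal] (p : ℕ) [Fact p.Prime]
    {N : ℕ} [NeZero N] {K : Type} [Field K] [NumberField K]
    (Dt : ModularParametrizationData W N) (H : HeegnerDatum N (NumberField.discr K))
    (ιK : K →+* ℂ) (P : (W.baseChange K).toAffine.Point)
    (f : CuspForm (CongruenceSubgroup.Gamma0 N) 2) (hfW : IsNewformOf W f)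
    (hp2 : p ≠ 2) (hmult : W.HasMultiplicativeReductionAtPrime p) (hN : W.conductorNorm ℤ = N)
    (hK : IsImaginaryQuadratic K) (hd4 : NumberField.discr K < -4) (hHN : SatisfiesHeegnerHypothesis N K)
    (hP : WeierstrassCurve.Affine.Point.map ιK.toRatAlgHom P = heegnerPointComplex Dt H)
    (hc : ¬ (p : ℤ) ∣ Dt.c) (hPinf : ¬ IsOfFinAddOrder P)
    (κ : ZpExtension K p) (hκ : κ.IsAnticyclotomic) (γ : Field.absoluteGaloisGroup K)
    [hγ : Fact (κ.IsTopGenerator γ)] (𝔭 : HeightOneSpectrum (𝓞 K)) (h𝔭 : ((p : ℕ) : 𝓞 K) ∈ 𝔭.asIdeal)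
    (he : 𝔭.asIdeal.ramificationIdx (𝓞 ℚ) = 1) (hf : 𝔭.asIdeal.inertiaDeg (𝓞 ℚ) = 1)
    (ι' : PadicAlgCl p ≃+* ℂ)
    (hι' : ∀ (w' : InfinitePlace K) (k : 𝓞 K), k ∈ 𝔭.asIdeal ↔ ‖ι'.symm (w'.embedding (k : K))‖ < 1)
    {ΩK : ℂ} {Ωp : ℂ_[p]} {Q : PowerSeries 𝓞_ℂ_[p]} (hΩK : ΩK ≠ 0) (hΩp : Ωp ≠ 0)
    (hQ : R1.IsBDPLFunctionInt p ι' 𝔭 κ γ f ΩK Ωp Q) :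
    R1.BDPValueAtOneIntAt W p (embAt K p 𝔭 h𝔭 he hf) P Q (W.LFunction p) := by
  have hp : p.Prime := Fact.out
  subst hN
  have hpN : p ∣ W.conductorNorm ℤ := X11b.dvd_conductorNorm_of_mult (W := W) hmult
  have hp2N : ¬ p ^ 2 ∣ W.conductorNorm ℤ := X2.not_sq_dvd_conductorNorm_of_mult W p hmult
  have hemb : ∀ k : 𝓞 K, k ∈ 𝔭.asIdeal ↔ ‖embAt K p 𝔭 h𝔭 he hf (k : K)‖ < 1 :=
    mem_asIdeal_iff_norm_embAt_lt_one 𝔭 h𝔭 he hf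
  -- the continuous display from the LZZ input (virtual periods), at the embedding of the frame's prime
  obtain ⟨ΩK₀, Ωp₀, u₀, hΩK₀, hΩp₀, hu₀, hcont⟩ := X2.exists_continuousDisplay_of_lzzRoadInputIoo hL ι' W K 𝔭
    κ γ Dt H ιK (embAt K p 𝔭 h𝔭 he hf) P f hp2 hmult rfl hpN hp2N hK hd4 (hHN p hp hpN) h𝔭 hι' hHN hκ hγ.out
    hfW hc hP hemb
  -- the limit is non-zero: `a_p = ±1` at multiplicative `p`, `P` of infinite order, `‖u₀‖ = 1`
  have ha : ¬ (p : ℤ) ∣ W.LFunction p := X11b.R1.not_dvd_lFunction_of_mult hfW hmult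
  have hX : algebraMap ℚ_[p] ℂ_[p] (((1 : ℚ_[p]) - ((W.LFunction p : ℤ) : ℚ_[p]) * (p : ℚ_[p])⁻¹) *
      padicLogOmega W p (embAt K p 𝔭 h𝔭 he hf) P) ≠ 0 := by
    rw [map_ne_zero_iff _ (algebraMap ℚ_[p] ℂ_[p]).injective]
    refine mul_ne_zero ?_ ?_
    · intro h0
      have h := X11b.R1.norm_one_sub_div_eq p ha
      rw [h0, norm_zero] at h
      have hp0 : (0 : ℝ) < p := by exact_mod_cast hp.pos
      exact absurd h (ne_of_lt hp0)
    · rw [← X11b.R1.logOmega_eq_padicLogOmega]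
      exact X11b.R1.logOmega_ne_zero W p _ hPinf
  have hu₀0 : u₀ ≠ 0 := fun h0 ↦ by rw [h0, norm_zero] at hu₀; exact zero_ne_one hu₀
  have hc0 : u₀ * (algebraMap ℚ_[p] ℂ_[p] (((1 : ℚ_[p]) - ((W.LFunction p : ℤ) : ℚ_[p]) *
      (p : ℚ_[p])⁻¹) * padicLogOmega W p (embAt K p 𝔭 h𝔭 he hf) P)) ^ 2 ≠ 0 :=
    mul_ne_zero hu₀0 (pow_ne_zero _ hX)
  -- one-sided ♭-rigidity: the constant term of the frame `Q` is that limit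
  have heq := X11b.intSeries_constantCoeff_eq_of_isBDPLFunctionInt_of_continuousValues hp2 hK hκ hγ.out
    hΩK₀ hΩK hΩp₀ hΩp hcont hc0 hQ
  refine ⟨u₀, hu₀, ?_⟩
  rw [X11b.R1.logOmega_eq_padicLogOmega, ← heq]
  exact X11b.R1.intSeries_hasValueAt_zero p Q

/-- **The BDP value at `𝟙` for a ♭-frame at an odd multiplicative prime, FROM THE REFEREED LIU–ZHANG–ZHANG
FACT** (Duke 167 Thm. 1.5.1 ∧ Thm. 1.5.3, `LiuZhangZhang2018.thm151_thm153_modularCurve_heegnerVector`, p509230):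
§1 ∘ `X2.lzzRoadInputIoo_of_thm151_thm153`. Same data and conclusion as
`bdpValueAtOneIntAt_of_lzzRoadInputIoo` — ANY odd `p ‖ N`, either sign, no rank hypothesis. A
`conditional-result` (the fact is a hypothesis); nothing booked.
[cite: LiuZhangZhang2018, Thm. 1.5.1 and Remark 1.1.2 and Thm. 1.5.3 (Duke Math. J. 167 pp. 745–749)]
[cite: Castella2018, Thm. 3.2 (arXiv:1704.06608 p. 9) (shape of the conclusion)] -/
theorem bdpValueAtOneIntAt_of_thm151_thm153 (hF : LiuZhangZhang2018.thm151_thm153_modularCurve_heegnerVector)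
    (W : WeierstrassCurve ℚ) [W.IsElliptic] [W.IsGloballyMinimal] (p : ℕ) [Fact p.Prime]
    {N : ℕ} [NeZero N] {K : Type} [Field K] [NumberField K]
    (Dt : ModularParametrizationData W N) (H : HeegnerDatum N (NumberField.discr K))
    (ιK : K →+* ℂ) (P : (W.baseChange K).toAffine.Point)
    (f : CuspForm (CongruenceSubgroup.Gamma0 N) 2) (hfW : IsNewformOf W f)
    (hp2 : p ≠ 2) (hmult : W.HasMultiplicativeReductionAtPrime p) (hN : W.conductorNorm ℤ = N)
    (hK : IsImaginaryQuadratic K) (hd4 : NumberField.discr K < -4) (hHN : SatisfiesHeegnerHypothesis N K)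
    (hP : WeierstrassCurve.Affine.Point.map ιK.toRatAlgHom P = heegnerPointComplex Dt H)
    (hc : ¬ (p : ℤ) ∣ Dt.c) (hPinf : ¬ IsOfFinAddOrder P)
    (κ : ZpExtension K p) (hκ : κ.IsAnticyclotomic) (γ : Field.absoluteGaloisGroup K)
    [Fact (κ.IsTopGenerator γ)] (𝔭 : HeightOneSpectrum (𝓞 K)) (h𝔭 : ((p : ℕ) : 𝓞 K) ∈ 𝔭.asIdeal)
    (he : 𝔭.asIdeal.ramificationIdx (𝓞 ℚ) = 1) (hf : 𝔭.asIdeal.inertiaDeg (𝓞 ℚ) = 1)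
    (ι' : PadicAlgCl p ≃+* ℂ)
    (hι' : ∀ (w' : InfinitePlace K) (k : 𝓞 K), k ∈ 𝔭.asIdeal ↔ ‖ι'.symm (w'.embedding (k : K))‖ < 1)
    {ΩK : ℂ} {Ωp : ℂ_[p]} {Q : PowerSeries 𝓞_ℂ_[p]} (hΩK : ΩK ≠ 0) (hΩp : Ωp ≠ 0)
    (hQ : R1.IsBDPLFunctionInt p ι' 𝔭 κ γ f ΩK Ωp Q) :
    R1.BDPValueAtOneIntAt W p (embAt K p 𝔭 h𝔭 he hf) P Q (W.LFunction p) :=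
  bdpValueAtOneIntAt_of_lzzRoadInputIoo (X2.lzzRoadInputIoo_of_thm151_thm153 hF) W p Dt H ιK P f hfW hp2 hmult
    hN hK hd4 hHN hP hc hPinf κ hκ γ 𝔭 h𝔭 he hf ι' hι' hΩK hΩp hQ

/-! ## §2. The `p = 3` atom of twistback stub 3 (`hval3` of p633542 = v3 `stub_value3`) from LZZ + GZ + newforms -/

/-- **The BDP-value atom at `p = 3 ‖ N` of twistback stub 3 — VERBATIM the hypothesis `hval3` of
`…TwistbackThmDByName.heegnerIndexIdentityKRankOne_of_thmD_OPEN_of_value3` (= the signature of twistback v3's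
`stub_value3`) — from the REFEREED LZZ fact + newforms + Gross–Zagier.** At every Heegner datum of item -27489's
shape with `p = 3` (`W` globally minimal, `3 ‖ N` either sign, `E[3]` reducible, `K` imaginary quadratic with
`d_K` odd `< −4` and Heegner for `N`, `Dt` with `3 ∤ c(Dt)`, `P ↦ y_H` through an infinite place,
`r_an(E) + r_an(E^{(d_K)}) = 1`), for every anticyclotomic `(κ, γ)`, degree-one `𝔭 ∋ 3`, embedding datum `ι′`
inducing `𝔭` and ♭-frame `(Ω_K ≠ 0, ‖Ω_p‖ = 1, Q)` with Castella's interpolation property for `Dt.f`: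
`Q(𝟙) = u·((1 − a_3(E)·3⁻¹)·log_𝔭 P)²`, `‖u‖ = 1`. Proof: `ord_{s=1} L(E/K,s) = 1` (`analyticRankEK_eq_add_of`,
modularity from newforms) ⟹ `P` of infinite order (Gross–Zagier, `lDerivEK_ne_zero_iff_not_isOfFinAddOrder`);
then §1 (the `p = 3`, reducibility and rank binders are used only there / not at all). So the ONE typed atom of
the line's stub 3 is a consequence of PUBLISHED/REFEREED named facts; CONDITIONAL on them; nothing booked.
[cite: LiuZhangZhang2018, Thm. 1.5.1 and Remark 1.1.2 and Thm. 1.5.3 (Duke Math. J. 167 pp. 745–749)]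
[cite: GrossZagier1986, Thm. I.(6.3) and V.(2.1) (non-torsion of the Heegner point at ord L(E/K) = 1)]
[cite: Castella2018, Thm. 3.2 (arXiv:1704.06608 p. 9) (shape of the conclusion)] -/
theorem value3_of_thm151_thm153 (hnf : exists_isNewformOf)
    (hGZall : ∀ (N : ℕ) [NeZero N] (W : WeierstrassCurve ℚ) (K : Type) [Field K] [NumberField K],
      gross_zagier N W K)
    (hF : LiuZhangZhang2018.thm151_thm153_modularCurve_heegnerVector)
    (W : WeierstrassCurve ℚ) [W.IsElliptic] [W.IsGloballyMinimal] (p : ℕ) [Fact p.Prime]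
    (N : ℕ) [NeZero N] (K : Type) [Field K] [NumberField K]
    (Dt : ModularParametrizationData W N) (H : HeegnerDatum N (NumberField.discr K))
    (w : InfinitePlace K) (P : (W.baseChange K).toAffine.Point)
    (hp3 : p = 3) (hmult : W.HasMultiplicativeReductionAtPrime p) (_hred : ¬ W.HasIrreducibleModPGaloisRep p)
    (hr1 : W.analyticRank + (W.quadraticTwist (NumberField.discr K : ℚ)).analyticRank = 1)
    (hN : W.conductorNorm ℤ = N) (hK : IsImaginaryQuadratic K) (_hodd : Odd (NumberField.discr K))
    (hlt : NumberField.discr K < -4) (hHN : SatisfiesHeegnerHypothesis N K)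
    (hP : WeierstrassCurve.Affine.Point.map w.embedding.toRatAlgHom P = heegnerPointComplex Dt H)
    (hc : ¬ (p : ℤ) ∣ Dt.c)
    (κ : ZpExtension K p) (hκ : κ.IsAnticyclotomic) (γ : Field.absoluteGaloisGroup K)
    [Fact (κ.IsTopGenerator γ)] (𝔭 : HeightOneSpectrum (𝓞 K)) (h𝔭 : ((p : ℕ) : 𝓞 K) ∈ 𝔭.asIdeal)
    (he : 𝔭.asIdeal.ramificationIdx (𝓞 ℚ) = 1) (hf : 𝔭.asIdeal.inertiaDeg (𝓞 ℚ) = 1)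
    (ι' : PadicAlgCl p ≃+* ℂ)
    (hι' : ∀ (w' : InfinitePlace K) (k : 𝓞 K), k ∈ 𝔭.asIdeal ↔ ‖ι'.symm (w'.embedding (k : K))‖ < 1)
    (ΩK : ℂ) (Ωp : ℂ_[p]) (Q : PowerSeries 𝓞_ℂ_[p]) (hΩK : ΩK ≠ 0) (hΩp : ‖Ωp‖ = 1)
    (hQ : R1.IsBDPLFunctionInt p ι' 𝔭 κ γ Dt.f ΩK Ωp Q) :
    R1.BDPValueAtOneIntAt W p (embAt K p 𝔭 h𝔭 he hf) P Q (W.LFunction p) := by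
  have hp2 : p ≠ 2 := by omega
  have hmod : hasEntireLFunction_rat := WeierstrassCurve.hasEntireLFunction_rat_of_exists_isNewformOf hnf
  -- `P` non-torsion: Gross–Zagier on `ord_{s=1} L(E/K,s) = 1`
  have hEK : analyticRankEK W K = 1 := by rw [analyticRankEK_eq_add_of hmod W K]; exact hr1
  have hPH : IsHeegnerPoint N W K P := ⟨Dt, H, w.embedding, hP⟩
  have hPinf : ¬ IsOfFinAddOrder P :=
    (lDerivEK_ne_zero_iff_not_isOfFinAddOrder W N K (hGZall N W K) hK hHN hPH).mp
      (LDerivEK_ne_zero_of_analyticRankEK_eq_one W K hEK)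
  have hΩp0 : Ωp ≠ 0 := fun h0 ↦ by rw [h0, norm_zero] at hΩp; exact zero_ne_one hΩp
  exact bdpValueAtOneIntAt_of_thm151_thm153 hF W p Dt H w.embedding P Dt.f Dt.isNewformOf hp2 hmult hN hK hlt
    hHN hP hc hPinf κ hκ γ 𝔭 h𝔭 he hf ι' hι' hΩK hΩp0 hQ

/-! ## §3. Every odd `p`: the identity over `K` from Thm. D + PUBLISHED facts (no [cas-split], no atom) -/

/-- **Every odd `p ‖ N`, either sign, either rank orientation: `Ш(E/K)` finite and the Heegner-index identity
over `K` from Keller–Yin Thm. D BY NAME + PUBLISHED/REFEREED facts** (newforms, Poitou–Tate ×2, Hsieh 2014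
Thm. A, Gross–Zagier, GZK, Liu–Zhang–Zhang 2018 Thm. 1.5.1/1.5.3), the Heegner point read through an infinite
place. = `…TwistbackThmD.shaFinite_and_indexIdentityAt_of_thmD_OPEN_of_bdpValue` (LEAD g8, p632879) with its
value hypothesis `hval` supplied by §1 from the LZZ fact — so neither `5 ≤ p` nor [cas-split] nor the `p = 3`
atom appears. CONDITIONAL; nothing booked; BSD / MC proved for no curve. [claim: KellerYin2024, status: under-review]
[cite: KellerYin2024, Thm. D = Thm. 5.1.3 (arXiv:2402.12781v2 L306–L309)]
[cite: LiuZhangZhang2018, Thm. 1.5.1 and Thm. 1.5.3 (Duke Math. J. 167 pp. 748–749)]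
[cite: Castella2018, Thm. 2.3 and §5 (5.1)–(5.3) (arXiv:1704.06608 pp. 5, 12)] [cite: Hsieh2014, Thm. A (p. 712)] -/
theorem shaFinite_and_indexIdentityAt_of_thmD_OPEN_of_thm151_thm153
    (hnf : exists_isNewformOf)
    (hPT : ∀ (K : Type) [Field K] [NumberField K], poitouTate_selmerStructure_duality K)
    (hPT2 : ∀ (K : Type) [Field K] [NumberField K], poitouTate_sha_tateDual K)
    (hH : hsieh2014_exists_anticyclotomicPAdicLFunction)
    (hF : LiuZhangZhang2018.thm151_thm153_modularCurve_heegnerVector)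
    (hD : KellerYin2024.thmD_imcMult_exists_isBDPLFunction_isTorsion_charIdeal_eq_OPEN)
    (hGZK : rank_eq_analyticRank_of_analyticRank_le_one)
    (W : WeierstrassCurve ℚ) [W.IsElliptic] [W.IsGloballyMinimal] (p : ℕ) [Fact p.Prime]
    (N : ℕ) [NeZero N] (K : Type) [Field K] [NumberField K]
    (Dt : ModularParametrizationData W N) (H : HeegnerDatum N (NumberField.discr K))
    (w : InfinitePlace K) (P : (W.baseChange K).toAffine.Point)
    (hGZ : gross_zagier N W K)
    (hp2 : p ≠ 2) (hmult : W.HasMultiplicativeReductionAtPrime p)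
    (hred : ¬ W.HasIrreducibleModPGaloisRep p)
    (hr1 : W.analyticRank + (W.quadraticTwist (NumberField.discr K : ℚ)).analyticRank = 1)
    (hN : W.conductorNorm ℤ = N) (hK : IsImaginaryQuadratic K) (hodd : Odd (NumberField.discr K))
    (hlt : NumberField.discr K < -4) (hHN : SatisfiesHeegnerHypothesis N K)
    (hP : WeierstrassCurve.Affine.Point.map w.embedding.toRatAlgHom P = heegnerPointComplex Dt H)
    (hc : ¬ (p : ℤ) ∣ Dt.c) :
    Finite (W.baseChange K).sha ∧ X11b.IndexIdentityAt W p K P := by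
  have hmod : hasEntireLFunction_rat := WeierstrassCurve.hasEntireLFunction_rat_of_exists_isNewformOf hnf
  -- `P` non-torsion (Gross–Zagier on `ord L(E/K) = 1`), for the value block
  have hEK : analyticRankEK W K = 1 := by rw [analyticRankEK_eq_add_of hmod W K]; exact hr1
  have hPH : IsHeegnerPoint N W K P := ⟨Dt, H, w.embedding, hP⟩
  have hPinf : ¬ IsOfFinAddOrder P :=
    (lDerivEK_ne_zero_iff_not_isOfFinAddOrder W N K hGZ hK hHN hPH).mp
      (LDerivEK_ne_zero_of_analyticRankEK_eq_one W K hEK)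
  exact shaFinite_and_indexIdentityAt_of_thmD_OPEN_of_bdpValue hnf hPT hPT2 hH hD hGZK W p N K Dt H w P
    hGZ hp2 hmult hred hr1 hN hK hodd hlt hHN hP hc
    (fun κ hκ γ _ 𝔭 h𝔭 he hf ι' hι' ΩK Ωp Q hΩK hΩp hQ ↦
      bdpValueAtOneIntAt_of_thm151_thm153 hF W p Dt H w.embedding P Dt.f Dt.isNewformOf hp2 hmult hN hK hlt
        hHN hP hc hPinf κ hκ γ 𝔭 h𝔭 he hf ι' hι' hΩK
        (fun h0 ↦ by rw [h0, norm_zero] at hΩp; exact zero_ne_one hΩp) hQ)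

/-- **Every odd `p ‖ N`, the Heegner point read through ANY `ι : K →+* ℂ`** — EXACTLY the binder shape of the
route's support item stmt-BirchSwinnertonDyer-27489 `EisensteinPrimes.HeegnerIndexIdentityKRankOne` (`p ≠ 2`,
multiplicative, `E[p]` reducible, `r_an(E) + r_an(E^{(d_K)}) = 1`, conductor `N`, `K` imaginary quadratic, `d_K`
odd `< -4`, Heegner for `N`, `P ↦ y_H` through `ι`, `p ∤ c(Dt)`, `Ш(E/K)` finite), conclusion
`X11b.IndexIdentityAt W p K P` — from Thm. D BY NAME + PUBLISHED/REFEREED facts (newforms, PT ×2, Hsieh, GZ,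
GZK, LZZ). `…TwistbackThmD.indexIdentityAt_of_thmD_OPEN_pNew` WITHOUT `5 ≤ p` and WITHOUT [cas-split]: the
infinite-place transport `exists_point_map_embedding_eq` (§0 there) + §3 here. The `Finite Ш(E/K)` hypothesis is
re-derived, kept for the shape. CONDITIONAL; nothing booked. [claim: KellerYin2024, status: under-review]
[cite: KellerYin2024, Thm. D = Thm. 5.1.3 (arXiv:2402.12781v2 L306–L309)]
[cite: LiuZhangZhang2018, Thm. 1.5.1 and Thm. 1.5.3 (Duke Math. J. 167 pp. 748–749)]
[cite: GrossLMS1991, §2 Conj. (2.2) (the identity's shape)] [cite: Castella2018, §5 (5.3) (p. 12)] -/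
theorem indexIdentityAt_of_thmD_OPEN_of_thm151_thm153
    (hnf : exists_isNewformOf)
    (hPT : ∀ (K : Type) [Field K] [NumberField K], poitouTate_selmerStructure_duality K)
    (hPT2 : ∀ (K : Type) [Field K] [NumberField K], poitouTate_sha_tateDual K)
    (hH : hsieh2014_exists_anticyclotomicPAdicLFunction)
    (hF : LiuZhangZhang2018.thm151_thm153_modularCurve_heegnerVector)
    (hD : KellerYin2024.thmD_imcMult_exists_isBDPLFunction_isTorsion_charIdeal_eq_OPEN)
    (hGZK : rank_eq_analyticRank_of_analyticRank_le_one)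
    (hGZall : ∀ (N : ℕ) [NeZero N] (W : WeierstrassCurve ℚ) (K : Type) [Field K] [NumberField K],
      gross_zagier N W K)
    (W : WeierstrassCurve ℚ) [W.IsElliptic] [W.IsGloballyMinimal] (p : ℕ) [Fact p.Prime]
    (N : ℕ) [NeZero N] (K : Type) [Field K] [NumberField K]
    (Dt : ModularParametrizationData W N) (H : HeegnerDatum N (NumberField.discr K)) (ι : K →+* ℂ)
    (P : (W.baseChange K).toAffine.Point)
    (hp2 : p ≠ 2) (hmult : W.HasMultiplicativeReductionAtPrime p)
    (hred : ¬ W.HasIrreducibleModPGaloisRep p)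
    (hr1 : W.analyticRank + (W.quadraticTwist (NumberField.discr K : ℚ)).analyticRank = 1)
    (hN : W.conductorNorm ℤ = N) (hK : IsImaginaryQuadratic K) (hodd : Odd (NumberField.discr K))
    (hlt : NumberField.discr K < -4) (hHN : SatisfiesHeegnerHypothesis N K)
    (hP : WeierstrassCurve.Affine.Point.map ι.toRatAlgHom P = heegnerPointComplex Dt H)
    (hc : ¬ (p : ℤ) ∣ Dt.c) (_hfin : Finite (W.baseChange K).sha) :
    X11b.IndexIdentityAt W p K P := by
  obtain ⟨w⟩ := (inferInstance : Nonempty (InfinitePlace K))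
  obtain ⟨P', hP', hidx⟩ := exists_point_map_embedding_eq W hK.1 ι w P
  rw [hP] at hP'
  obtain ⟨-, hid⟩ := shaFinite_and_indexIdentityAt_of_thmD_OPEN_of_thm151_thm153 hnf hPT hPT2 hH hF hD hGZK
    W p N K Dt H w P' (hGZall N W K) hp2 hmult hred hr1 hN hK hodd hlt hHN hP' hc
  unfold X11b.IndexIdentityAt at hid ⊢
  rw [hidx] at hid
  exact hid

end Summit.BirchSwinnertonDyer.BirchSwinnertonDyer.Theorems.EisensteinPrimesMazurMCOnCellBTwistbackValueOfLZZ

end
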